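import Literature.Computability.AlgebraicComplexity.ZariskiClosureBaseChange
import Literature.Computability.AlgebraicComplexity.CharacterizedByStabilizerSL
import HarnessLib

/-!
# The space of forms fixed by the `SL`-stabiliser is invariant under extension of scalars
# (the algebraic Lefschetz principle, part III)

For a polynomial `g` over an algebraically closed field `k`, an extension field `K`, and a degree
`r`, the `K`-dimension of `fixedForms (slSubgroup σ K) g_K r` (the degree-`r` forms over `K` fixed by
`SL_n(K) ∩ Stab(g_K)`; Mulmuley–Sohoni's `W^{H}` for `W = Sym^r`, the multiplicity datum of GCT I
Thm. 5.1 = the tree's fact `MS2001_thm_5_1`) equals the `k`-dimension of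
`fixedForms (slSubgroup σ k) g r` (`finrank_fixedForms_map`). THEOREMS ONLY, plus one bookkeeping
`def` (`stabIdeal g`, the equations `det Y = 1, Y · g = g` of the `SL`-stabiliser).

Proof. (≥) a form `p` over `k` fixed by `Stab_{SL_n(k)}(g)` has base change fixed by
`Stab_{SL_n(K)}(g_K)`: the identity `coeff_e (Y · p) = coeff_e p` holds on the `k`-points of the
`k`-variety `stabIdeal g`, hence on its `K`-points (Nullstellensatz, `k` algebraically closed:
Milne, Algebraic Groups, Cor. 1.17 / A.48 — `H(k)` is dense in `H` for `k` algebraically closed);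
and base change preserves linear independence (`linearIndependent_map`). (≤) a form over `K` fixed
by `Stab_{SL_n(K)}(g_K)` is fixed by the images of `Stab_{SL_n(k)}(g)`; decomposing it along a
`k`-basis of `K` (`ZariskiClosureBaseChange` § 1) the components are fixed by `Stab_{SL_n(k)}(g)`,
so it lies in the `K`-span of the base change of the `k`-space (the fixed space of a set of
`k`-rational operators commutes with extension of scalars; Milne Prop. 1.11 proof, flatness).

Honest framing: bookkeeping for the cell's literature ledger (row MS2001-A); nothing here bears on
VP versus VNP.

## References

* K. Mulmuley, M. Sohoni, *Geometric complexity theory I*, SIAM J. Comput. 31 (2001), Thm. 5.1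
  (`W^H`, `W^Q`); GCT II (2008) §1 ("characterized by its stabilizer").
  [MulmuleySohoniSIAM2001] [MulmuleySohoniGCT2SIAM2008]
* J. S. Milne, *Algebraic Groups*, CUP (2017), Prop. 1.11, Cor. 1.17, A.48 (held text
  `book:milnend-algebraic-groups`). [Milne2017AlgebraicGroups]

## Provenance

Cell `val-lit`, seat `val-lit-x3` generation 5 (programme #10, lead-bip RULING 2026-08-27 11:03Z).
-/

noncomputable section

open MvPolynomial

namespace Literature.Computability.AlgebraicComplexity

/-! ### § 1 The `SL`-stabiliser in matrix form and as a `k`-variety -/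

section Stabilizer

variable {k K : Type*} [Field k] [Field K] [Algebra k K] {σ : Type*} [Fintype σ] [DecidableEq σ]

/-- Membership in `fixedForms (slSubgroup σ k) g r` in matrix terms: a form of degree `r` fixed by
every matrix of determinant `1` that fixes `g`.
[cite: MulmuleySohoniGCT2SIAM2008, §1 (definition of "characterized by its stabilizer")] -/
theorem mem_fixedForms_slSubgroup_iff {g p : MvPolynomial σ k} {r : ℕ} :
    p ∈ fixedForms (slSubgroup σ k) g r ↔ p.IsHomogeneous r ∧
      ∀ B : Matrix σ σ k, B.det = 1 → linSubst σ k B g = g → linSubst σ k B p = p := by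
  rw [mem_fixedForms_iff]
  constructor
  · rintro ⟨hp, h⟩
    refine ⟨hp, fun B hB hBg => ?_⟩
    have h1 := h (Matrix.SpecialLinearGroup.toGL ⟨B, hB⟩)
      (mem_slSubgroup_iff.mpr (by rw [Matrix.SpecialLinearGroup.coe_GL_coe_matrix]; exact hB))
    rw [linSubstRep_apply, linSubstRep_apply, Matrix.SpecialLinearGroup.coe_GL_coe_matrix] at h1
    exact h1 hBg
  · rintro ⟨hp, h⟩
    refine ⟨hp, fun γ hγ hγg => ?_⟩
    rw [linSubstRep_apply] at hγg ⊢
    exact h _ (mem_slSubgroup_iff.mp hγ) hγg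

/-- The equations of the `SL`-stabiliser of `g`: `det Y = 1` and `coeff_d (Y · g) = coeff_d g` for
every monomial `d` — an ideal of polynomials over `k` in the matrix entries.
[cite: MulmuleySohoniGCT2SIAM2008, §1 (the stabilizer `G_v`)] -/
def stabIdeal (g : MvPolynomial σ k) : Ideal (MvPolynomial (σ × σ) k) :=
  Ideal.span (insert ((Matrix.mvPolynomialX σ σ k).det - 1)
    (Set.range fun d : σ →₀ ℕ => genericCoeff g d - C (coeff d g)))

/-- The determinant of the generic matrix evaluates to the determinant. [folklore] -/
private theorem aeval_det_mvPolynomialX' {S : Type*} [CommRing S] [Algebra k S] (A : Matrix σ σ S) :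
    aeval (fun ij : σ × σ => A ij.1 ij.2) (Matrix.mvPolynomialX σ σ k).det = A.det := by
  rw [AlgHom.map_det, Matrix.mvPolynomialX_mapMatrix_aeval]

/-- **`K`-points of the stabiliser variety**: a matrix `A` over `K` is a zero of `stabIdeal g`
iff `det A = 1` and `A · g_K = g_K`. [cite: MulmuleySohoniGCT2SIAM2008, §1 (the stabilizer `G_v`)] -/
theorem mem_zeroLocus_stabIdeal_iff (g : MvPolynomial σ k) (A : Matrix σ σ K) :
    (fun ij : σ × σ => A ij.1 ij.2) ∈ MvPolynomial.zeroLocus K (stabIdeal g) ↔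
      A.det = 1 ∧ linSubst σ K A (map (algebraMap k K) g) = map (algebraMap k K) g := by
  rw [stabIdeal, MvPolynomial.zeroLocus_span]
  constructor
  · intro h
    refine ⟨?_, ?_⟩
    · have h1 := h _ (Set.mem_insert _ _)
      rwa [map_sub, map_one, aeval_det_mvPolynomialX', sub_eq_zero] at h1
    · ext d
      have h1 := h _ (Set.mem_insert_of_mem _ ⟨d, rfl⟩)
      rwa [map_sub, aeval_genericCoeff, aeval_C, sub_eq_zero, ← coeff_map] at h1
  · rintro ⟨hdet, hfix⟩ q hq
    rcases hq with rfl | ⟨d, rfl⟩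
    · rw [map_sub, map_one, aeval_det_mvPolynomialX', hdet, sub_self]
    · rw [map_sub, aeval_genericCoeff, aeval_C, hfix, coeff_map, sub_self]

/-- **`k`-points of the stabiliser variety**: a matrix `B` over `k` is a zero of `stabIdeal g` iff
`det B = 1` and `B · g = g`. [cite: MulmuleySohoniGCT2SIAM2008, §1 (the stabilizer `G_v`)] -/
theorem mem_zeroLocus_stabIdeal_iff_self (g : MvPolynomial σ k) (B : Matrix σ σ k) :
    (fun ij : σ × σ => B ij.1 ij.2) ∈ MvPolynomial.zeroLocus k (stabIdeal g) ↔
      B.det = 1 ∧ linSubst σ k B g = g := by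
  have h := mem_zeroLocus_stabIdeal_iff (K := k) g B
  rwa [Algebra.algebraMap_self, map_id] at h

end Stabilizer

/-! ### § 2 Base change of fixed forms: the `k`-space maps into the `K`-space -/

section Ascent

variable {k K : Type*} [Field k] [Field K] [Algebra k K] {σ : Type*} [Fintype σ] [DecidableEq σ]

/-- **A form fixed by `Stab_{SL_n(k)}(g)` has base change fixed by `Stab_{SL_n(K)}(g_K)`** (`k`
algebraically closed): `Stab_{SL_n(k)}(g)` is Zariski dense in the stabiliser `k`-variety, so the
identity `Y · p = p` passes from its `k`-points to its `K`-points (Milne Cor. 1.17 / A.48; here by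
the Nullstellensatz). [cite: Milne2017AlgebraicGroups, Cor. 1.17 / A.48] -/
theorem map_mem_fixedForms_map [IsAlgClosed k] {g p : MvPolynomial σ k} {r : ℕ}
    (hp : p ∈ fixedForms (slSubgroup σ k) g r) :
    map (algebraMap k K) p ∈ fixedForms (slSubgroup σ K) (map (algebraMap k K) g) r := by
  rw [mem_fixedForms_slSubgroup_iff] at hp ⊢
  refine ⟨hp.1.map _, fun A hA hAg => ?_⟩
  ext e
  -- the identity `coeff_e (Y · p) = coeff_e p` on the stabiliser variety
  have hk : ∀ x ∈ MvPolynomial.zeroLocus k (stabIdeal g),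
      aeval x (genericCoeff p e - C (coeff e p)) = 0 := by
    intro x hx
    have hx' : x = fun ij : σ × σ => (Matrix.of fun i j : σ => x (i, j)) ij.1 ij.2 := rfl
    rw [hx'] at hx ⊢
    obtain ⟨hdet, hfix⟩ := (mem_zeroLocus_stabIdeal_iff_self g _).mp hx
    have h1 := aeval_genericCoeff (K := k) p e (Matrix.of fun i j : σ => x (i, j))
    rw [Algebra.algebraMap_self, map_id] at h1
    rw [map_sub, h1, aeval_C, Algebra.algebraMap_self, RingHom.id_apply, hp.2 _ hdet hfix, sub_self]
  have hK := aeval_eq_zero_of_forall_zeroLocus (K := K) (stabIdeal g) hk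
    ((mem_zeroLocus_stabIdeal_iff g A).mpr ⟨hA, hAg⟩)
  rwa [map_sub, aeval_genericCoeff, aeval_C, sub_eq_zero, ← coeff_map] at hK

/-- **Base change preserves linear independence of polynomials**: a `k`-linearly independent
family of polynomials over `k` has `K`-linearly independent base change (the polynomial ring over
`K` is free over the one over `k` on a `k`-basis of `K`; Milne Prop. 1.11, proof).
[cite: Milne2017AlgebraicGroups, Prop. 1.11 (proof; `k'` flat over `k`)] -/
theorem linearIndependent_map {ι τ : Type*} {v : ι → MvPolynomial τ k} (hv : LinearIndependent k v) :
    LinearIndependent K (fun i => map (algebraMap k K) (v i)) := by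
  classical
  rw [linearIndependent_iff'] at hv ⊢
  intro s c hc i hi
  let e := Module.Basis.ofVectorSpace k K
  let J : Finset (Module.Basis.ofVectorSpaceIndex k K) := s.biUnion fun i => (e.repr (c i)).support
  -- the relation, rewritten along the basis `e`
  have hci : ∀ i' ∈ s, c i' = ∑ j ∈ J, e.repr (c i') j • e j := by
    intro i' hi'
    have hsub : (e.repr (c i')).support ⊆ J :=
      Finset.subset_biUnion_of_mem (fun i => (e.repr (c i)).support) hi'
    rw [← Finset.sum_subset hsub (fun j _ hj => by
      rw [Finsupp.notMem_support_iff.mp hj, zero_smul])]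
    conv_lhs => rw [← e.linearCombination_repr (c i')]
    rw [Finsupp.linearCombination_apply, Finsupp.sum]
  have key : ∑ j ∈ J, C (e j) * map (algebraMap k K) (∑ i' ∈ s, e.repr (c i') j • v i') = 0 := by
    rw [← hc]
    have hterm : ∀ i' ∈ s, c i' • map (algebraMap k K) (v i') =
        ∑ j ∈ J, C (e j) * map (algebraMap k K) (e.repr (c i') j • v i') := by
      intro i' hi'
      conv_lhs => rw [hci i' hi']
      rw [Finset.sum_smul]
      refine Finset.sum_congr rfl fun j _ => ?_
      simp only [Algebra.smul_def, MvPolynomial.algebraMap_eq, map_mul, map_C]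
      ring
    rw [Finset.sum_congr rfl hterm, Finset.sum_comm]
    refine Finset.sum_congr rfl fun j _ => ?_
    rw [map_sum, Finset.mul_sum]
  have hQ := eq_zero_of_sum_basis_mul_map_eq_zero e J (fun j => ∑ i' ∈ s, e.repr (c i') j • v i') key
  -- every coordinate of `c i` vanishes
  have hcoord : ∀ j, e.repr (c i) j = 0 := by
    intro j
    by_cases hj : j ∈ J
    · exact hv s (fun i' => e.repr (c i') j) (hQ j hj) i hi
    · by_contra hne
      exact hj (Finset.mem_biUnion.mpr ⟨i, hi, Finsupp.mem_support_iff.mpr hne⟩)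
  have hrepr : e.repr (c i) = 0 := Finsupp.ext fun j => by rw [hcoord, Finsupp.zero_apply]
  exact (LinearEquiv.map_eq_zero_iff e.repr).mp hrepr

end Ascent

/-! ### § 3 Base change of fixed forms: the `K`-space is spanned by the `k`-space -/

section Descent

variable {k K : Type*} [Field k] [Field K] [Algebra k K] {σ : Type*} [Fintype σ] [DecidableEq σ]

omit [DecidableEq σ] in
/-- Linear substitution over `K` of a decomposed polynomial: `A_K · (∑ b_j (Q_j)_K) = ∑ b_j (A · Q_j)_K`
for a matrix `A` over `k`. [cite: Milne2017AlgebraicGroups, §1.e (extension of scalars)] -/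
theorem linSubst_sum_basis_mul_map {ι' : Type*} (b : ι' → K) (J : Finset ι')
    (Q : ι' → MvPolynomial σ k) (A : Matrix σ σ k) :
    linSubst σ K (A.map (algebraMap k K)) (∑ j ∈ J, C (b j) * map (algebraMap k K) (Q j)) =
      ∑ j ∈ J, C (b j) * map (algebraMap k K) (linSubst σ k A (Q j)) := by
  rw [map_sum]
  refine Finset.sum_congr rfl fun j _ => ?_
  rw [map_mul, linSubst_C, ← map_linSubst]

/-- **A form over `K` fixed by `Stab_{SL_n(K)}(g_K)` lies in the `K`-span of the base change of
`fixedForms (slSubgroup σ k) g r`**: its components along a `k`-basis of `K` are fixed by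
`Stab_{SL_n(k)}(g)` (the fixed space of `k`-rational operators commutes with extension of
scalars). [cite: Milne2017AlgebraicGroups, Prop. 1.11 (proof; `k'` flat over `k`)] -/
theorem fixedForms_map_le_span (g : MvPolynomial σ k) (r : ℕ) :
    fixedForms (slSubgroup σ K) (map (algebraMap k K) g) r ≤
      Submodule.span K (map (algebraMap k K) '' (fixedForms (slSubgroup σ k) g r : Set _)) := by
  classical
  intro P hP
  rw [mem_fixedForms_slSubgroup_iff] at hP
  obtain ⟨hPhom, hPfix⟩ := hP
  let e := Module.Basis.ofVectorSpace k K
  -- each basis component of `P` is a fixed form over `k`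
  have hcomp : ∀ j, basisComponent e j P ∈ fixedForms (slSubgroup σ k) g r := by
    intro j
    rw [mem_fixedForms_slSubgroup_iff]
    refine ⟨fun d hd => hPhom (fun h0 => hd (by rw [coeff_basisComponent, h0, map_zero,
      Finsupp.zero_apply])), fun B hB hBg => ?_⟩
    by_cases hj : j ∈ basisIndexSet e P
    · -- apply `B_K` to the decomposition of `P`
      have hBK : linSubst σ K (B.map (algebraMap k K)) (map (algebraMap k K) g) =
          map (algebraMap k K) g := by rw [← map_linSubst, hBg]
      have hdetK : (B.map (algebraMap k K)).det = 1 := by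
        rw [← RingHom.mapMatrix_apply, ← RingHom.map_det, hB, map_one]
      have hfix := hPfix _ hdetK hBK
      conv_lhs at hfix => rw [eq_sum_basisComponent e P, linSubst_sum_basis_mul_map]
      conv_rhs at hfix => rw [eq_sum_basisComponent e P]
      rw [← sub_eq_zero, ← Finset.sum_sub_distrib] at hfix
      have hfix' : ∑ j ∈ basisIndexSet e P, C (e j) * map (algebraMap k K)
          (linSubst σ k B (basisComponent e j P) - basisComponent e j P) = 0 := by
        rw [← hfix]
        refine Finset.sum_congr rfl fun j _ => ?_
        rw [map_sub, mul_sub]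
      have h0 := eq_zero_of_sum_basis_mul_map_eq_zero e _ _ hfix' j hj
      exact sub_eq_zero.mp h0
    · rw [basisComponent_eq_zero_of_notMem hj, map_zero]
  -- hence `P` lies in the span
  rw [eq_sum_basisComponent e P]
  refine Submodule.sum_mem _ fun j _ => ?_
  rw [← smul_eq_C_mul]
  exact Submodule.smul_mem _ _ (Submodule.subset_span ⟨_, hcomp j, rfl⟩)

/-- **The `K`-space of fixed forms is the `K`-span of the base change of the `k`-space** (`k`
algebraically closed). [cite: Milne2017AlgebraicGroups, Prop. 1.11 / Cor. 1.17] -/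
theorem span_map_fixedForms_eq [IsAlgClosed k] (g : MvPolynomial σ k) (r : ℕ) :
    Submodule.span K (map (algebraMap k K) '' (fixedForms (slSubgroup σ k) g r : Set _)) =
      fixedForms (slSubgroup σ K) (map (algebraMap k K) g) r := by
  refine le_antisymm (Submodule.span_le.mpr ?_) (fixedForms_map_le_span g r)
  rintro _ ⟨p, hp, rfl⟩
  exact map_mem_fixedForms_map hp

/-- **The dimension of the space of fixed forms is invariant under extension of scalars** (`k`
algebraically closed): `dim_K (Sym^r K^n)^{Stab_{SL_n(K)}(g_K)} = dim_k (Sym^r k^n)^{Stab_{SL_n(k)}(g)}`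
— the multiplicity datum of GCT I Thm. 5.1 does not depend on the algebraically closed field over
which it is computed. [cite: MulmuleySohoniSIAM2001, Thm. 5.1 (`W^H`, `W^Q`)] -/
theorem finrank_fixedForms_map [IsAlgClosed k] (g : MvPolynomial σ k) (r : ℕ) :
    Module.finrank K (fixedForms (slSubgroup σ K) (map (algebraMap k K) g) r) =
      Module.finrank k (fixedForms (slSubgroup σ k) g r) := by
  classical
  set W := fixedForms (slSubgroup σ k) g r with hW
  haveI : Module.Finite k (homogeneousSubmodule σ k r) := finite_homogeneousSubmodule σ k r
  haveI : Module.Finite k W :=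
    Module.Finite.of_injective (Submodule.inclusion (fun p (hp : p ∈ W) => hp.1))
      (Submodule.inclusion_injective _)
  let bW := Module.finBasis k W
  -- the base change of a `k`-basis of `W` is a `K`-basis of the `K`-space of fixed forms
  have hli : LinearIndependent K (fun i => map (algebraMap k K) ((bW i : W) : MvPolynomial σ k)) :=
    linearIndependent_map (bW.linearIndependent.map' W.subtype (Submodule.ker_subtype W))
  have hspan : Submodule.span K (Set.range fun i => map (algebraMap k K) ((bW i : W) : MvPolynomial σ k)) =
      fixedForms (slSubgroup σ K) (map (algebraMap k K) g) r := by
    rw [← span_map_fixedForms_eq]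
    refine le_antisymm (Submodule.span_mono ?_) (Submodule.span_le.mpr ?_)
    · rintro _ ⟨i, rfl⟩
      exact ⟨_, (bW i).2, rfl⟩
    · rintro _ ⟨p, hp, rfl⟩
      have hrepr : (p : MvPolynomial σ k) = ∑ i, bW.repr ⟨p, hp⟩ i • ((bW i : W) : MvPolynomial σ k) := by
        conv_lhs => rw [show p = ((⟨p, hp⟩ : W) : MvPolynomial σ k) from rfl, ← bW.sum_repr ⟨p, hp⟩]
        rw [Submodule.coe_sum]
        rfl
      rw [hrepr, map_sum]
      refine Submodule.sum_mem _ fun i _ => ?_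
      rw [smul_eq_C_mul, map_mul, map_C, ← smul_eq_C_mul]
      exact Submodule.smul_mem _ _ (Submodule.subset_span ⟨i, rfl⟩)
  rw [← hspan, finrank_span_eq_card hli, Fintype.card_fin]

end Descent

end Literature.Computability.AlgebraicComplexity

end
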